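import Literature.MathematicalPhysics.QuantumLattice.SU2Haar
import Literature.MathematicalPhysics.QuantumFieldTheory.SU2HiggsKeyEstimate
import Literature.AlgebraicTopology.FundamentalGroup.RotationGroupSO3
import HarnessLib

/-!
# Crux `NonSimplyConnectedLatticeGap` (stmt-QuantumFields-16405), route `ConvexGribovBody`, line `Sketch` —
# stub `stub_sphere_mulEquiv_su2` (I5: the unit quaternions are `SU(2)` as a topological group)

Skeleton line `Sketch` v3 of the crux
`Summit.QuantumFields.YangMills.Theses.ConvexGribovBody.NonSimplyConnectedLatticeGap` certifies the first
admissible instance `G = SO(3) = S³/{±1}` of the crux's hypothesis class (compact simple gauge groups with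
`π₁(G) ≠ 0`). The tree proves `IsSimpleCompactGroup (Matrix.specialUnitaryGroup (Fin 2) ℂ)`; to move it to the
unit quaternions `S³ = Metric.sphere (0 : ℍ) 1` (the domain of the covering homomorphism `rotHom : S³ →* SO(3)`)
the line needs `S³ ≅ SU(2)` as TOPOLOGICAL GROUPS. This file proves the registered side-stub I5:

* the tree's quaternion model `quatMatrix : ℍ → M₂(ℂ)`, `q = z + w j ↦ [[z, w], [-w̄, z̄]]`
  (`Literature.MathematicalPhysics.QuantumLattice.SU2Haar`: multiplicative, `quatMatrix 1 = 1`, unit quaternions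
  land in `SU(2)`, every `U ∈ SU(2)` is `quatMatrix (su2Quat U)` with `‖su2Quat U‖ = 1`, continuous) restricts to
  a monoid homomorphism `S³ →* SU(2)`;
* it is injective (tree: `Literature.MathematicalPhysics.QuantumFieldTheory.quatMatrix_injective`, the first row of
  `quatMatrix q` lists the four real coordinates of `q`) and surjective (`quatMatrix_su2Quat`), hence a group
  isomorphism `MulEquiv.ofBijective`;
* it is continuous, and a continuous bijection from the compact `S³` to the Hausdorff `SU(2)` has a continuous
  inverse (`Continuous.continuous_symm_of_equiv_compact_to_t2`).

The helper lemma is prefixed `sphereSU2_`. No named unproved facts are used; no new objects are defined.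
-/

set_option autoImplicit false

noncomputable section

namespace Summit.QuantumFields.YangMills.Theorems.NonSimplyConnectedLatticeGap

open Literature.MathematicalPhysics.QuantumLattice

/-- `quatMatrix` restricted to the unit sphere of `ℍ`, as a map into `SU(2)`, is continuous. [folklore] -/
theorem sphereSU2_continuous_codRestrict :
    Continuous fun q : Metric.sphere (0 : Quaternion ℝ) 1 =>
      (⟨quatMatrix (q : Quaternion ℝ), quatMatrix_mem_specialUnitaryGroup (norm_eq_of_mem_sphere q)⟩ :
        Matrix.specialUnitaryGroup (Fin 2) ℂ) :=
  (continuous_quatMatrix.comp continuous_subtype_val).subtype_mk _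

/-- **STUB I5 — the unit quaternions are `SU(2)` as a topological group**: `quatMatrix` restricts to a group
isomorphism `S³ ≃* SU(2)` that is a homeomorphism (tree: `quatMatrix_mul`, `quatMatrix_mem_specialUnitaryGroup`,
`quatMatrix_su2Quat`, `continuous_quatMatrix`; continuous bijection compact → Hausdorff). [folklore] -/
theorem stub_sphere_mulEquiv_su2 :
    ∃ e : Metric.sphere (0 : Quaternion ℝ) 1 ≃* Matrix.specialUnitaryGroup (Fin 2) ℂ,
      Continuous e ∧ Continuous e.symm ∧
      ∀ q : Metric.sphere (0 : Quaternion ℝ) 1,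
        ((e q : Matrix.specialUnitaryGroup (Fin 2) ℂ) : Matrix (Fin 2) (Fin 2) ℂ) =
          Literature.MathematicalPhysics.QuantumLattice.quatMatrix (q : Quaternion ℝ) := by
  -- the restriction of `quatMatrix` to `S³`, as a monoid homomorphism into `SU(2)`
  let f : Metric.sphere (0 : Quaternion ℝ) 1 →* Matrix.specialUnitaryGroup (Fin 2) ℂ :=
    { toFun := fun q =>
        ⟨quatMatrix (q : Quaternion ℝ), quatMatrix_mem_specialUnitaryGroup (norm_eq_of_mem_sphere q)⟩
      map_one' := Subtype.ext (by simp [Metric.unitSphere.coe_one, quatMatrix_one])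
      map_mul' := fun p q => Subtype.ext (by simp [Metric.unitSphere.coe_mul, quatMatrix_mul]) }
  have hf : ∀ q : Metric.sphere (0 : Quaternion ℝ) 1,
      ((f q : Matrix.specialUnitaryGroup (Fin 2) ℂ) : Matrix (Fin 2) (Fin 2) ℂ) =
        quatMatrix (q : Quaternion ℝ) := fun q => rfl
  have hinj : Function.Injective f := by
    intro p q h
    apply Subtype.ext
    apply Literature.MathematicalPhysics.QuantumFieldTheory.quatMatrix_injective
    rw [← hf, ← hf, h]
  have hsurj : Function.Surjective f := by
    intro U
    refine ⟨⟨su2Quat U, by rw [mem_sphere_zero_iff_norm, norm_su2Quat]⟩, Subtype.ext ?_⟩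
    rw [hf]
    exact quatMatrix_su2Quat U
  -- the group isomorphism and its topology
  let e : Metric.sphere (0 : Quaternion ℝ) 1 ≃* Matrix.specialUnitaryGroup (Fin 2) ℂ :=
    MulEquiv.ofBijective f ⟨hinj, hsurj⟩
  have he : ∀ q, e q = f q := fun q => rfl
  have hcont : Continuous e := by
    have h : (⇑e : Metric.sphere (0 : Quaternion ℝ) 1 → Matrix.specialUnitaryGroup (Fin 2) ℂ) = fun q =>
        ⟨quatMatrix (q : Quaternion ℝ), quatMatrix_mem_specialUnitaryGroup (norm_eq_of_mem_sphere q)⟩ :=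
      funext fun q => by rw [he]; rfl
    rw [h]
    exact sphereSU2_continuous_codRestrict
  have hsymm : Continuous e.symm :=
    Continuous.continuous_symm_of_equiv_compact_to_t2 (f := e.toEquiv) hcont
  exact ⟨e, hcont, hsymm, fun q => by rw [he, hf]⟩

end Summit.QuantumFields.YangMills.Theorems.NonSimplyConnectedLatticeGap
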